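import Literature.MathematicalPhysics.QuantumFieldTheory.Balaban1983to89.T4HistoryLipschitzRecursion
import Literature.MathematicalPhysics.QuantumFieldTheory.Balaban1983to89.T4CouplingAnalyticity

/-!
# T4HistoryLipschitzBridge — the two NE9 fan-out typings agree: ONE renewal layer, ONE family of moduli
(cell `pub-balaban`, T4-DAG §2 node U3 / §5 row T4-U3.E / §6 NE9; seat NE9-P2, the inductive member; bookkeeping only)

HONEST FRAMING (T4-DAG PAGE 1).  The cell's T4 target is rung (B)+1 on a FIXED finite torus — NOT infinite volume, NOT a
mass gap, NOT the Clay problem.  NE9 (`T4OutputRate.NE9` ∧ `T4OutputRate.FadingMemory`) is NOT PRINTED in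
[Balaban1987RG1] / [Balaban1988RG2Cluster] / [Balaban1988Convergent] (cell records `t4/T4-XREAD-U3.md`, `t4/T4-EST-NE9-P1.md`,
`t4/T4-EST-NE9-P2.md`); neither fan-out module proves it, and this bridge proves nothing about Bałaban's terms either.  It
records, in the kernel, that the two typings of the cell's missing step inequality — the NORM-LEVEL `StepTransfer V W ℓ a ω₀`
of `T4CouplingAnalyticity` (seat P1: activities in a seminormed space, constants from Cauchy estimates) and the
FUNCTIONAL-LEVEL `StepLipschitz E W κ lam a` of `T4HistoryLipschitzRecursion` (seat P2: majorant form on the terms, any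
window) — run through ONE renewal layer (P2's `RenewalSuper` / `renewal_coeff_le`) and return THE SAME moduli:
`T4HistoryLipschitzRecursion.prodModuli ℓ (fun _ => μ) = T4CouplingAnalyticity.geomMod ℓ μ` (`prodModuli_const_eq_geomMod`).
Concretely: (i) a norm-level one-step shape with GENERAL coefficients, `NormStepLipschitz V W lam a` (P1's `StepTransfer` is
the instance `lam ≡ ℓ`, `a k j = a·ω₀^{k−j}`, `normStepLipschitz_of_stepTransfer`), gives `T4CouplingAnalyticity.NormNE9 V W Λ`
for EVERY super-solution `Λ` of P2's renewal inequalities (`normNE9_of_normStepLipschitz` — the norm-level twin of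
`T4HistoryLipschitzRecursion.ne9_of_stepLipschitz`, same Fubini step `renewal_coeff_le`); (ii) P1's
input `StepTransfer` run through that layer gives `NormNE9 V W (prodModuli ℓ (fun _ => ω₀ + a))`
(`normNE9_prodModuli_of_stepTransfer`) — by (`prodModuli_const_eq_geomMod`) literally the statement of P1's own
`normNE9_of_stepTransfer`, which is used BY NAME and not restated — and composes with P1's evaluation lemma `ne9_of_normNE9`
(`ne9_prodModuli_of_stepTransfer`); (iii) P2's headline
`ne9_and_fadingMemory_of_geometricStep` is restated on `geomMod` (`ne9_geomMod_of_geometricStep`), so downstream (node U5b)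
sees one modulus family whichever member is instantiated; (iv) the per-step product family `prodModuli ℓ μ` (one factor per
step) has no norm-level counterpart in P1's module and is available to it through (i) (`normNE9_prodModuli_of_normStep`).
The conditional inputs of the cell's other nodes (BetaPertH, (B), (B^μ)) do not occur here.  Value = de-duplication of the
fan-out's bookkeeping (cell journal NOTE of seat P1, «ONE renewal layer»); NOT summit progress.

MATHEMATICAL CONTENT: `funext` + the closed form `prodModuli_const`; a strong induction on the creation step using
`renewal_coeff_le`; reassociation of a product.  Everything [folklore].  Imports the two fan-out modules BY NAME and modifies
neither.
-/

noncomputable section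

namespace Literature.MathematicalPhysics.QuantumFieldTheory.Balaban1983to89.T4HistoryLipschitzBridge

open scoped BigOperators
open Literature.MathematicalPhysics.QuantumFieldTheory.Balaban1983to89.T4OutputRate
open Literature.MathematicalPhysics.QuantumFieldTheory.Balaban1983to89.T4HistoryLipschitzRecursion
open Literature.MathematicalPhysics.QuantumFieldTheory.Balaban1983to89.T4CouplingAnalyticity

/-! ## §1 One family of moduli -/

/-- **THE TWO SEATS' MODULI COINCIDE**: P2's product family at a constant rate IS P1's geometric family,
`prodModuli ℓ (fun _ => μ) k i = geomMod ℓ μ k i = ℓ μ^{k−1−i}·[i < k]`. [folklore] -/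
theorem prodModuli_const_eq_geomMod (ℓ μ : ℝ) : prodModuli ℓ (fun _ => μ) = geomMod ℓ μ := by
  funext k i
  rw [prodModuli_const]
  rfl

/-- P2's headline restated on P1's moduli: `ScaleZeroFree`, `StepLipschitz E W κ lam a`, `lam k ≤ ℓ`, `a k j ≤ c·ω^{k−j}`
give `NE9 E W κ (geomMod ℓ (ω + c)) ∧ FadingMemory (ℓ/(ω + c)) (ω + c) (geomMod ℓ (ω + c))`. [folklore] -/
theorem ne9_geomMod_of_geometricStep {C : Carriers} {Bg : Type} {E : Functional C Bg} {W : Set (ℕ → ℝ)}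
    {κ ℓ c ω : ℝ} {lam : ℕ → ℝ} {a : ℕ → ℕ → ℝ} (h0 : ScaleZeroFree E W) (hS : StepLipschitz E W κ lam a)
    (hℓ : 0 ≤ ℓ) (hc : 0 ≤ c) (hω : 0 ≤ ω) (hpos : 0 < ω + c) (hlam : ∀ k, lam k ≤ ℓ)
    (ha : ∀ k j, j ≤ k → a k j ≤ c * ω ^ (k - j)) :
    NE9 E W κ (geomMod ℓ (ω + c)) ∧ FadingMemory (ℓ / (ω + c)) (ω + c) (geomMod ℓ (ω + c)) := by
  rw [← prodModuli_const_eq_geomMod]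
  exact ne9_and_fadingMemory_of_geometricStep h0 hS hℓ hc hω hpos hlam ha

/-! ## §2 The norm-level one-step shape with general coefficients, through P2's renewal layer -/

section NormLevel

variable {F : Type*} [SeminormedAddCommGroup F]

/-- SHAPE (binder; NOT PRINTED — the norm-level twin of `T4HistoryLipschitzRecursion.StepLipschitz`, generalising
`T4CouplingAnalyticity.StepTransfer` to step- and creation-step-dependent coefficients): the activity born at step k + 1
depends on the last coupling with constant `lam k` and on the old activities born at the steps j ≤ k with constants `a k j`:
`‖V (k+1) g − V (k+1) g′‖ ≤ lam k·|g_k − g′_k| + Σ_{j≤k} a k j·‖V j g − V j g′‖`.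
[cite: Balaban1987RG1, (2.12)-(2.13) p.268 and (0.29) p.258] -/
def NormStepLipschitz (V : ℕ → (ℕ → ℝ) → F) (W : Set (ℕ → ℝ)) (lam : ℕ → ℝ) (a : ℕ → ℕ → ℝ) : Prop :=
  ∀ k, ∀ g ∈ W, ∀ g' ∈ W,
    ‖V (k + 1) g - V (k + 1) g'‖ ≤
      lam k * |g k - g' k| + ∑ j ∈ Finset.range (k + 1), a k j * ‖V j g - V j g'‖

/-- P1's `StepTransfer V W ℓ a ω₀` is the instance `lam ≡ ℓ`, `a k j = a·ω₀^{k−j}` of `NormStepLipschitz`. [folklore] -/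
theorem normStepLipschitz_of_stepTransfer {V : ℕ → (ℕ → ℝ) → F} {W : Set (ℕ → ℝ)} {ℓ a ω₀ : ℝ}
    (h : StepTransfer V W ℓ a ω₀) : NormStepLipschitz V W (fun _ => ℓ) (fun k j => a * ω₀ ^ (k - j)) := by
  intro k g hg g' hg'
  have hk := h k g hg g' hg'
  simpa only [Finset.mul_sum, mul_assoc] using hk

/-- **NORM-LEVEL NE9 THROUGH THE RENEWAL LAYER**: a coupling-free scale-0 activity, `NormStepLipschitz V W lam a` with
`a k j ≥ 0`, and ANY super-solution `Λ` of the renewal inequalities `RenewalSuper lam a Λ` give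
`T4CouplingAnalyticity.NormNE9 V W Λ`.  Strong induction on the creation step; the step is `renewal_coeff_le` (the same
Fubini swap that drives `ne9_of_stepLipschitz`). [folklore] -/
theorem normNE9_of_normStepLipschitz {V : ℕ → (ℕ → ℝ) → F} {W : Set (ℕ → ℝ)} {lam : ℕ → ℝ} {a Λ : ℕ → ℕ → ℝ}
    (h0 : ∀ g ∈ W, ∀ g' ∈ W, V 0 g = V 0 g') (hS : NormStepLipschitz V W lam a)
    (ha : ∀ k j, j ≤ k → 0 ≤ a k j) (hΛ : RenewalSuper lam a Λ) : NormNE9 V W Λ := by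
  intro n
  induction' n using Nat.strong_induction_on with n ih
  intro g hg g' hg'
  cases n with
  | zero => simp [h0 g hg g' hg']
  | succ k =>
    calc ‖V (k + 1) g - V (k + 1) g'‖
        ≤ lam k * |g k - g' k| + ∑ j ∈ Finset.range (k + 1), a k j * ‖V j g - V j g'‖ := hS k g hg g' hg'
      _ ≤ lam k * |g k - g' k| +
            ∑ j ∈ Finset.range (k + 1), a k j * ∑ i ∈ Finset.range j, Λ j i * |g i - g' i| := by
          refine add_le_add le_rfl (Finset.sum_le_sum fun j hj => ?_)
          have hj' := Finset.mem_range.mp hj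
          exact mul_le_mul_of_nonneg_left (ih j hj' g hg g' hg') (ha k j (Nat.lt_succ_iff.mp hj'))
      _ ≤ ∑ i ∈ Finset.range (k + 1), Λ (k + 1) i * |g i - g' i| :=
          renewal_coeff_le hΛ k (δ := fun i => |g i - g' i|) fun i => abs_nonneg _

/-- PER-STEP RATES at the norm level (P2's product family, not available in P1's module): `NormStepLipschitz` with
`lam k ≤ ℓ`, `a k j ≤ c·Π_{m=j+1}^{k} ω_m` (ω_m, c ≥ 0) gives `NormNE9 V W (prodModuli ℓ μ)` for any per-step rates
`μ_m ≥ ω_m + c`. [folklore] -/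
theorem normNE9_prodModuli_of_normStep {V : ℕ → (ℕ → ℝ) → F} {W : Set (ℕ → ℝ)} {lam : ℕ → ℝ} {a : ℕ → ℕ → ℝ}
    {ℓ c : ℝ} {ω μ : ℕ → ℝ} (h0 : ∀ g ∈ W, ∀ g' ∈ W, V 0 g = V 0 g') (hS : NormStepLipschitz V W lam a)
    (ha0 : ∀ k j, j ≤ k → 0 ≤ a k j) (hℓ : 0 ≤ ℓ) (hc : 0 ≤ c) (hω : ∀ m, 0 ≤ ω m) (hμ : ∀ m, ω m + c ≤ μ m)
    (hlam : ∀ k, lam k ≤ ℓ) (ha : ∀ k j, j ≤ k → a k j ≤ c * ∏ m ∈ Finset.Ico (j + 1) (k + 1), ω m) :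
    NormNE9 V W (prodModuli ℓ μ) :=
  normNE9_of_normStepLipschitz h0 hS ha0 (renewalSuper_prodModuli hℓ hc hω hμ hlam ha)

/-- **P1's INPUT THROUGH P2's RENEWAL LAYER**: `StepTransfer V W ℓ a ω₀` ↦ `NormStepLipschitz` (`normStepLipschitz_of_stepTransfer`)
↦ `RenewalSuper` solved by `renewalSuper_geometric` ↦ `NormNE9 V W (prodModuli ℓ (fun _ => ω₀ + a))`.  Rewriting the conclusion
with `prodModuli_const_eq_geomMod` gives LITERALLY the statement of `T4CouplingAnalyticity.normNE9_of_stepTransfer` (P1's own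
proof, by `aggDisc_step`); that declaration is NOT restated here — use it by name (the cell's scratch trailer
`t4/b2b-balaban-t4-ne9-p2/trailer_bridge.lean` elaborates both proofs against the one fully-qualified type). [folklore] -/
theorem normNE9_prodModuli_of_stepTransfer {V : ℕ → (ℕ → ℝ) → F} {W : Set (ℕ → ℝ)} {ℓ a ω₀ : ℝ} (hℓ : 0 ≤ ℓ)
    (ha : 0 ≤ a) (hω : 0 ≤ ω₀) (h0 : ∀ g ∈ W, ∀ g' ∈ W, V 0 g = V 0 g') (hstep : StepTransfer V W ℓ a ω₀) :
    NormNE9 V W (prodModuli ℓ (fun _ => ω₀ + a)) :=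
  normNE9_of_normStepLipschitz h0 (normStepLipschitz_of_stepTransfer hstep)
    (fun _ _ _ => mul_nonneg ha (pow_nonneg hω _))
    (renewalSuper_geometric hℓ ha hω (fun _ => le_rfl) fun _ _ _ => le_rfl)

/-- … composed with P1's evaluation lemma `ne9_of_normNE9` and P2's `fadingMemory_geometric`:
`T4OutputRate.NE9 E W κ (prodModuli ℓ (fun _ => ω₀ + a)) ∧ T4OutputRate.FadingMemory (ℓ/(ω₀ + a)) (ω₀ + a) (…)` for a
functional that evaluates the activity through an `e^{−κd}`-Lipschitz map — the conclusion of P1's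
`ne9_and_fadingMemory_of_stepTransfer` on P2's modulus family (equal to P1's by `prodModuli_const_eq_geomMod`). [folklore] -/
theorem ne9_prodModuli_of_stepTransfer {C : Carriers} {Bg : Type} {E : Functional C Bg} {V : ℕ → (ℕ → ℝ) → F}
    {W : Set (ℕ → ℝ)} {κ ℓ a ω₀ : ℝ} (ev : F → Bg → C.Dom → ℝ)
    (hev : ∀ (b b' : F) (U : Bg) (X : C.Dom), |ev b U X - ev b' U X| ≤ Real.exp (-(κ * C.d X)) * ‖b - b'‖)
    (hE : ∀ g ∈ W, ∀ (U : Bg) (X : C.Dom), E g U X = ev (V (C.scale X) g) U X) (hℓ : 0 ≤ ℓ) (ha : 0 ≤ a)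
    (hω : 0 ≤ ω₀) (hμ : 0 < ω₀ + a) (h0 : ∀ g ∈ W, ∀ g' ∈ W, V 0 g = V 0 g') (hstep : StepTransfer V W ℓ a ω₀) :
    NE9 E W κ (prodModuli ℓ (fun _ => ω₀ + a)) ∧
      FadingMemory (ℓ / (ω₀ + a)) (ω₀ + a) (prodModuli ℓ (fun _ => ω₀ + a)) :=
  ⟨ne9_of_normNE9 ev hev hE (normNE9_prodModuli_of_stepTransfer hℓ ha hω h0 hstep), fadingMemory_geometric hℓ hμ⟩

end NormLevel

end Literature.MathematicalPhysics.QuantumFieldTheory.Balaban1983to89.T4HistoryLipschitzBridge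

end
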